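import Summits.ResolutionOfSingularities.ResolutionOfSingularities.Theorems.SandwichedSingularitiesResolution
import Summits.ResolutionOfSingularities.ResolutionOfSingularities.Theorems.ValuativePatchingRelBlowupExtension
import Literature.AlgebraicGeometry.Resolution.ProperModelsRegLeification
import Literature.AlgebraicGeometry.Resolution.CompletedPullbackRegular
import Literature.AlgebraicGeometry.Resolution.CanonicalResolutionProofs
import Literature.AlgebraicGeometry.Resolution.BlowupsFlatBaseChange
import HarnessLib

/-!
# Crux `PatchingRel` (stmt-ResolutionOfSingularities-0642), line `sandwiched-gluing` (v3 cut):
# the strong blow-up atom — SAND⁺ᵇ ⇒ SANDᵇ with no gluing and no compactification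

A variety `X` over a field `k` which is regular off an open `V` (the datum of SANDʷ / SANDᵇ) has
its singular locus `Sing X` INSIDE `V` and CLOSED in `X` (the regular locus of a scheme locally of
finite type over a field is open, `isOpen_regularLocus_of_locallyOfFiniteType_field`); the
singular locus of the open subscheme `V` is `Sing X` itself. Consequently a blowing up
`Bl_J V → V` along an ideal sheaf `J` on `V` whose cosupport `V(J)` consists of singular points
of `V` EXTENDS to `X` for free: the push-forward ideal `I := J.map V.ι` restricts to `J`
(`comap_map_of_isOpenImmersion`), its cosupport is the closure of `V(J)` (`support_map`), which
stays inside the closed set `Sing X ⊆ V`, and its blowing up `Bl_I X → X` is `Bl_J V` over `V`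
(`exists_isPullback_of_isBlowup_opens`, blowing up commutes with open immersions) and an
isomorphism over `X ∖ V(I) ⊇ X ∖ V ⊆ Reg X` (`IsBlowup.isIso_compl`). So if `Bl_J V` is regular,
`Bl_I X` is regular: `exists_isBlowup_of_isBlowup_opens_of_regular_off`.

Hence the v3 STRONG atom SAND⁺ᵇ(p) (`SandwichedStrongBlowupResolution p`: a sandwiched variety
`V` — proper and birational over a regular variety — admits a Sing-admissible blow-up
desingularization) implies SANDᵇ(p) (`sandwichedBlowupResolution_of_sandwichedStrongBlowup`,
registered stub `stub_sandwichedBlowup_of_sandwichedStrongBlowup`), hence (capstone file) SANDᴸ(p), SANDʷ(p) and the crux.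
Compare the gen-0 cut, where the STRONG atom SAND⁺ (an abstract strong resolution of `V`) needed
two-piece gluing (`OpenGluing`) and Nagata compactification to reach the crux: in blow-up format
both disappear. Zariski's patching (Piltant 2013, Prop. 5.1) thus needs, for a local resolver
whose output is a Sing-admissible blowing up, no compactification, no gluing, no bad points and
no lower-dimensional resolution.

## References

* O. Piltant, *An axiomatic version of Zariski's patching theorem*, RACSAM 107 (2013) 91–121,
  Prop. 5.1 (proof, Step 2: blow up the Zariski closure of the centre). [Piltant2013]
* U. Görtz, T. Wedhorn, *Algebraic Geometry I*, 2nd ed. (2020), Prop. 13.91 (2)–(3).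
  [GortzWedhorn2020]
* H. Matsumura, *Commutative Ring Theory* (1987), §30, Cor. to Thm. 30.5 (openness of the regular
  locus of a finitely generated algebra over a field). [Matsumura1987]
-/

-- `Summit.<Summit>.<Sub>.Theorems` with `Sub = Summit` (single-conjunct summit, D-0017): the
-- duplicated namespace component is the tree layout.
set_option linter.dupNamespace false

noncomputable section

namespace Summit.ResolutionOfSingularities.ResolutionOfSingularities.Theorems

open CategoryTheory AlgebraicGeometry TopologicalSpace
open Literature.AlgebraicGeometry.Resolution

universe u

/-- **A Sing-admissible blowing-up resolution of an open extends, when the ambient is regular off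
the open.** Let `X` be an integral scheme locally of finite type over a field, `V ⊆ X` an open
with every point of `X ∖ V` regular, and `π : V' → V` a blowing up of `V` along a non-zero ideal
sheaf `J` whose cosupport consists of singular points, with `V'` regular. Then the push-forward
ideal `I := J.map V.ι` is non-zero, its cosupport consists of singular points of `X`, and its
blowing up has regular source: over `V` it is `V'` (blowing up commutes with open immersions),
and over `X ∖ V(I) ⊇ X ∖ V` it is an isomorphism onto a regular open.
[cite: Piltant2013, Prop. 5.1 (proof, Step 2)] -/
theorem exists_isBlowup_of_isBlowup_opens_of_regular_off {k : Type u} [Field k] {X : Scheme.{u}}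
    (g : X ⟶ Spec (.of k)) [LocallyOfFiniteType g] [IsIntegral X] (V : X.Opens)
    (hout : ∀ x : X, x ∉ V → IsRegularLocalRing (X.presheaf.stalk x))
    {J : (V : Scheme.{u}).IdealSheafData} {V' : Scheme.{u}} {π : V' ⟶ (V : Scheme.{u})}
    (hJ : J ≠ ⊥)
    (hJsing : ∀ x : (V : Scheme.{u}), x ∈ J.support →
      ¬ IsRegularLocalRing ((V : Scheme.{u}).presheaf.stalk x))
    (hπ : IsBlowup π J) (hreg : Scheme.IsRegular V') :
    ∃ (I : X.IdealSheafData) (X' : Scheme.{u}) (ρ : X' ⟶ X),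
      I ≠ ⊥ ∧ (∀ x : X, x ∈ I.support → ¬ IsRegularLocalRing (X.presheaf.stalk x)) ∧
        IsBlowup ρ I ∧ Scheme.IsRegular X' := by
  haveI : IsLocallyNoetherian X := LocallyOfFiniteType.isLocallyNoetherian g
  -- extend the blowing up along the push-forward ideal `I := J.map V.ι`
  obtain ⟨Z, ρ, s, -, -, -, hs, hsq, hblow⟩ := exists_isPullback_of_isBlowup_opens V hJ hπ
  haveI := hs
  set I : X.IdealSheafData := J.map V.ι with hIdef
  -- the cosupport of `I` is the closure of that of `J`, which lies in the CLOSED set `Sing X`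
  have hsing_closed : IsClosed {x : X | ¬ IsRegularLocalRing (X.presheaf.stalk x)} := by
    have := isOpen_regularLocus_of_locallyOfFiniteType_field g
    rw [← isOpen_compl_iff]
    convert this using 1
    ext x
    simp [Scheme.mem_regularLocus]
  have hIsupp : ∀ x : X, x ∈ I.support → ¬ IsRegularLocalRing (X.presheaf.stalk x) := by
    intro x hx
    have hx' : x ∈ closure (V.ι '' (J.support : Set (V : Scheme.{u}))) := by
      have := Scheme.IdealSheafData.support_map J V.ι
      rw [hIdef] at hx
      rw [this] at hx
      exact hx
    have hsub : V.ι '' (J.support : Set (V : Scheme.{u})) ⊆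
        {x : X | ¬ IsRegularLocalRing (X.presheaf.stalk x)} := by
      rintro _ ⟨v, hv, rfl⟩ hreg'
      exact hJsing v hv ((isRegularLocalRing_stalk_iff_of_isOpenImmersion V.ι v).mp hreg')
    exact hsing_closed.closure_subset_iff.mpr hsub hx'
  have hI : I ≠ ⊥ := by
    intro h
    apply hJ
    have := Literature.AlgebraicGeometry.Limits.comap_map_of_isOpenImmersion V.ι J
    rw [← this, ← hIdef, h, Scheme.IdealSheafData.comap_bot]
  refine ⟨I, Z, ρ, hI, hIsupp, hblow, fun z => ?_⟩
  by_cases hz : ρ z ∈ V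
  · -- over `V`: `Z ×_X V = V'` is regular
    exact isRegularLocalRing_stalk_of_isPullback_ι hsq (S := (V : Set X)) le_rfl
      (fun m _ => hreg m) z hz
  · -- off `V`: `ρ` is an isomorphism near `z` and `X` is regular at `ρ z`
    let W : X.Opens := ⟨(I.support : Set X)ᶜ, I.support.isClosed.isOpen_compl⟩
    haveI : IsIso (ρ ∣_ W) := hblow.isIso_compl
    have hzW : ρ z ∈ W := fun h => hz (by
      -- points of the cosupport are singular, hence in `V`
      by_contra hzV
      exact hIsupp _ h (hout _ hzV))
    have := (mem_regularLocus_iff_of_isIso_morphismRestrict ρ W z hzW).mpr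
      ((Scheme.mem_regularLocus _).mpr (hout _ hz))
    exact (Scheme.mem_regularLocus z).mp this

/-- **SAND⁺ᵇ(p) ⇒ SANDᵇ(p)**: a Sing-admissible blow-up desingularization of the sandwiched
piece `V` of a variety `X` regular off `V` extends to a blow-up desingularization of `X`
(`exists_isBlowup_of_isBlowup_opens_of_regular_off`); if `V = ∅` the variety `X` is regular and
the blowing up of the unit ideal does it. No gluing, no compactification.
[cite: Piltant2013, Prop. 5.1 (proof, Step 2)] -/
theorem sandwichedBlowupResolution_of_sandwichedStrongBlowup {p : ℕ}
    (hS : SandwichedStrongBlowupResolution.{u} p) : SandwichedBlowupResolution.{u} p := by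
  intro k _ _ U X f g V η hf₁ hf₂ hf₃ hU hUreg hg₁ hg₂ hg₃ hX hη hbir hcompat hout
  haveI := hf₁; haveI := hf₂; haveI := hf₃; haveI := hU; haveI := hg₁; haveI := hg₂
  haveI := hg₃; haveI := hX; haveI := hη
  haveI : IsLocallyNoetherian X := LocallyOfFiniteType.isLocallyNoetherian g
  by_cases hVne : (V : Set X).Nonempty
  swap
  · -- `V = ∅`: `X` is regular; blow up the unit ideal
    refine ⟨⊤, X, 𝟙 X, ?_, isBlowup_id_top X, fun x => hout x fun hx => hVne ⟨x, hx⟩⟩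
    intro h
    have h1 : ((⊤ : X.IdealSheafData).support : Set X) = Set.univ := by
      rw [h, Scheme.IdealSheafData.support_bot]; rfl
    rw [Scheme.IdealSheafData.support_top] at h1
    exact (Set.univ_nonempty.ne_empty h1.symm).elim
  haveI : Nonempty (V : Scheme.{u}) := by
    obtain ⟨x, hx⟩ := hVne
    exact ⟨⟨x, hx⟩⟩
  haveI : IsIntegral (V : Scheme.{u}) := isIntegral_of_isOpenImmersion V.ι
  obtain ⟨J, V', π, hJ, hJsing, hπ, hreg⟩ :=
    hS k U (V : Scheme.{u}) f η inferInstance inferInstance inferInstance inferInstance hUreg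
      inferInstance hη hbir
  obtain ⟨I, X', ρ, hI, -, hρ, hreg'⟩ :=
    exists_isBlowup_of_isBlowup_opens_of_regular_off g V hout hJ hJsing hπ hreg
  exact ⟨I, X', ρ, hI, hρ, hreg'⟩

/-- **Registered stub B8 of line `sandwiched-gluing` (v3 cut)** (crux
stmt-ResolutionOfSingularities-0642, universe `0`): SAND⁺ᵇ(p) ⇒ SANDᵇ(p).
[cite: Piltant2013, Prop. 5.1 (proof, Step 2)] -/
theorem stub_sandwichedBlowup_of_sandwichedStrongBlowup :
    ∀ p : ℕ, SandwichedStrongBlowupResolution.{0} p → SandwichedBlowupResolution.{0} p :=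
  fun _ hS => sandwichedBlowupResolution_of_sandwichedStrongBlowup hS

/-- The strong format statement for ALL varieties gives every atom of the line:
`StrongBlowupResolutionInChar p ⇒` SANDᵇ(p) (through SAND⁺ᵇ(p); also through
`BlowupResolutionInChar p`). [folklore] -/
theorem sandwichedBlowupResolution_of_strongBlowupResolutionInChar {p : ℕ}
    (h : StrongBlowupResolutionInChar.{u} p) : SandwichedBlowupResolution.{u} p :=
  sandwichedBlowupResolution_of_sandwichedStrongBlowup
    (sandwichedStrongBlowupResolution_of_strongBlowupResolutionInChar h)

end Summit.ResolutionOfSingularities.ResolutionOfSingularities.Theorems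

end
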